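import Summits.BirchSwinnertonDyer.BirchSwinnertonDyer.Theorems.ErratumRoadFiveClassicalValueFromPrint
import Summits.BirchSwinnertonDyer.BirchSwinnertonDyer.Theorems.ErratumRoadFiveControlFromJSWMult
import Summits.BirchSwinnertonDyer.Rank1Residual.X11b.LocalTorsionTamagawa
import HarnessLib

/-!
# Route `ErratumRoadFive` (K2 at `p ≥ 5`) — objects the route posits (Defs): the two DISJOINT branches of
# the crux `RamNoErratumDataAtFive` (REST‴, item stmt-BirchSwinnertonDyer-19624), and their lossless glue

Cell `bsd-stepL` (run/shared/lean/pub/bsd-stepL/), seat `bsd-stepL-rest-p2` (prover g0, 2026-08-26), planner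
g25's FIRST-ACT line ① (STATUS 12:12:38Z); `--supports stmt-BirchSwinnertonDyer-19624`. This module imports NO
Theses file (precedent `ByReductionTypeAtTwoOrdHalvesDefs.lean`): a route file MAY import it, so the planner's
`--split RamNoErratumDataAtFive` can type the two children BY NAME as the `@[conjecture]` constants below and cite
`rest3_of_branches` as the glue; the kernel consumer of REST‴
(`KernelFromPrint.openInputIMCBody_of_print_of_core_of_rest3_of_notRam`, p439441) receives
`rest3_of_branches hT hN` in place of its `hrest` binder unchanged.

REST‴ (the text of item 19624, VERBATIM): `∀ W p, Ram W p → ¬ ((∃ q prime, q ≠ 2 ∧ q ≠ p ∧ Mult W q ∧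
¬ Split W q ∧ p ∤ v_q(Δ_min)) ∧ (∀ P ∈ E(ℚ_p), p • P = 0 → P = 0)) → P2OpenInputOnTreeAt W p`. Its hypothesis
`¬ (oddWitness ∧ torsionFree)` is `¬ torsionFree ∨ (torsionFree ∧ ¬ oddWitness)`, a DISJOINT union:

* **branch (T)** `Rest3TorsionBranchAtFive` — the (ram) pairs with a NON-ZERO `p`-torsion point in `E(ℚ_p)`
  (erratum hypothesis (iv) fails). At a multiplicative `p ≥ 3` this forces `p` SPLIT, `p ∣ v_p(Δ_min)`,
  `p ∣ c_p`, `p ∣ ∏ c` (`LocalTorsion.split_and_dvd_of_localTorsion_ne_zero`): OFF the Locus, inside the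
  exceptional-zero sector (`rest3TorsionBranchAtFive_iff_sharp`).
* **branch (NW)** `Rest3NoWitnessBranchAtFive` — the (ram) pairs with `E(ℚ_p)[p] = 0` and NO odd non-split
  `E[p]`-ramified multiplicative `q ≠ p` (every odd ramified witness split, or the only non-split one is
  `q = 2`); the (ram) witness itself is then `2` or split (`exists_ramWitness_two_or_split_of_noOddNonsplitWitness`).

What this file proves (bookkeeping only): `rest3_of_branches` ((T) → (NW) → REST‴ verbatim),
the converses and `rest3_iff_branches` (the split is LOSSLESS), the X11b-sharp forms of both branches (the
crux's conclusion is vacuous off `ClassX11b ∧ 5 ≤ p ∧ Surj`), and the two standing REDUCTIONS restricted to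
each branch: branch ⟸ the VALUE-FREE shape (2.4)∃♭ `P2.IMCDivSomeFrameOnTree` on its rows + print (bdp g12,
p442735 `openInputOnTreeAt_of_imcDivSomeFrame_of_pNew`) and branch ⟸ the lower half `Typed.MissingLowerBoundAt`
on its rows + the Jetchev–Skinner–Wan control fact (imc-t1/imc-p1, p432484
`openInputOnTreeAt_of_missingLowerBoundAt_of_ram_of_thm331Mult`).

HONEST FRAMING: two `Prop` constants (restrictions of an OPEN crux; nothing asserted) and pure glue; no named
fact, no `sorry`; every bridge is CONDITIONAL on its displayed hypotheses; BSD is not advanced; no census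
word, tier or label moves (T7). Neither branch has a road in print: the erratum road needs an odd non-split
witness AND (iv) (imc-p1 `oddNonsplitWitness_and_localTorsion_of_thm11Hypotheses_of_odd_discr`, p437590); the
Kolyvagin road (SZ14♯, PRE) lives on the Locus `p ∤ ∏c`, which (T) misses entirely; BSTW 2024 (PRE) and
Yan–Zhu 2026 treat good `p` only. Census of record (imc-p1 g3, fold of multr1-p1 `census2_all_500k.tsv.gz`,
`N < 5·10⁵`, `p ≥ 5`): REST‴ ∩ (ram) = 703 204 class-wide pairs; the (T)/(NW) sizes are this seat's census
(HOME/rest/).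

References: [Castella2018Erratum] Thm. 1.1 (iii)–(iv), (2.4) (pp. 1, 4); [SilvermanATAEC1994] Cor. IV.9.2;
[Castella2018Exceptional] Thms. 2.10–2.11; [Castella2018] Thms. 2.3, 3.1, 3.2, §5; [JetchevSkinnerWan2017]
Thm. 3.3.1, §3.5 (3.5.c); [Skinner2016PacificMC] Thm. C; [MilneADT2006] Ch. I, Thm. 4.10(b), Thm. 2.8.
-/

set_option autoImplicit false
set_option linter.dupNamespace false

noncomputable section

open scoped Classical NumberField

open WeierstrassCurve NumberField IsDedekindDomain
open Literature.NumberTheory.EllipticCurves Literature.NumberTheory.EllipticCurves.GreenbergSelmer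
open Literature.NumberTheory.EllipticCurves.ModularForms
open Literature.NumberTheory.EllipticCurves.Rank1Residual
open Literature.NumberTheory.EllipticCurves.Rank1Residual.Typed
open Literature.NumberTheory.EllipticCurves.Castella2018
open Literature.NumberTheory.EllipticCurves.Castella2018Exceptional
open Literature.NumberTheory.EllipticCurves.JetchevSkinnerWan2017
open Literature.NumberTheory.GaloisRepresentations Literature.NumberTheory.GaloisCohomology
open Summit.BirchSwinnertonDyer.Rank1Residual Summit.BirchSwinnertonDyer.Rank1Residual.X11b

namespace Summit.BirchSwinnertonDyer.BirchSwinnertonDyer.Theorems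

/-! ### §0 The two branches (route-posited objects; nothing asserted) -/

/-- [crux branch (T) of item 19624 `RamNoErratumDataAtFive`] **REST‴ on the (ram) pairs WITH a non-zero
`p`-torsion point in `E(ℚ_p)`** (Castella's erratum hypothesis (iv) fails): route p2's composite open input
`P2OpenInputOnTreeAt W p` there. The clause texts are item 19624's sub-expressions (the torsion clause
negated). At the pairs where the conclusion is not vacuous (`ClassX11b W p`, `5 ≤ p`, `Surj W p`) the torsion
point forces `p` split multiplicative with `p ∣ v_p(Δ_min)` and `p ∣ c_p`
(`rest3TorsionBranchAtFive_iff_sharp`). No road in print (the erratum's Thm. 1.1 needs (iv); the Kolyvagin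
road needs `p ∤ ∏c`). A `Prop` constant; OPEN; nothing asserted.
[cite: Castella2018Erratum, Thm. 1.1 (iv) and Remark (pp. 1–2) (the excluded clause; nothing asserted)] -/
@[conjecture]
def Rest3TorsionBranchAtFive : Prop :=
  ∀ (W : WeierstrassCurve ℚ) [W.IsElliptic] [W.IsGloballyMinimal] (p : ℕ) [Fact p.Prime],
    Literature.NumberTheory.EllipticCurves.Rank1Residual.Ram W p →
    (∃ P : (W.baseChange ℚ_[p]).toAffine.Point, p • P = 0 ∧ P ≠ 0) →
    Summit.BirchSwinnertonDyer.Rank1Residual.X11b.P2OpenInputOnTreeAt W p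

/-- [crux branch (NW) of item 19624 `RamNoErratumDataAtFive`] **REST‴ on the (ram) pairs with
`E(ℚ_p)[p] = 0` and NO odd non-split `E[p]`-ramified multiplicative `q ≠ p`** (every odd multiplicative
`q ≠ p` with `p ∤ v_q(Δ_min)` is split, or the only non-split one is `q = 2`: Castella's erratum hypothesis
(iii) cannot be met with an odd `d_K`): route p2's composite open input `P2OpenInputOnTreeAt W p` there.
The two clause texts are item 19624's sub-expressions VERBATIM. No road in print (the erratum road needs a
non-split ramified `q` — the sign of `E/K` with `q ∣ d_K`; FW21 Thm. 4.41 ∕ Castella 2024 Thm. 3.1 (iii)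
likewise; SZ14♯ is a preprint and Locus-only). A `Prop` constant; OPEN; nothing asserted.
[cite: Castella2018Erratum, Thm. 1.1 (iii) (p. 1) (the excluded clause; nothing asserted)] -/
@[conjecture]
def Rest3NoWitnessBranchAtFive : Prop :=
  ∀ (W : WeierstrassCurve ℚ) [W.IsElliptic] [W.IsGloballyMinimal] (p : ℕ) [Fact p.Prime],
    Literature.NumberTheory.EllipticCurves.Rank1Residual.Ram W p →
    (∀ P : (W.baseChange ℚ_[p]).toAffine.Point, p • P = 0 → P = 0) →
    ¬ (∃ (q : ℕ) (_ : Fact q.Prime), q ≠ 2 ∧ q ≠ p ∧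
        Literature.NumberTheory.EllipticCurves.Rank1Residual.Mult W q ∧
        ¬ W.HasSplitMultiplicativeReductionAtPrime q ∧ ¬ p ∣ padicValInt q W.minimalDiscriminantInt) →
    Summit.BirchSwinnertonDyer.Rank1Residual.X11b.P2OpenInputOnTreeAt W p

/-! ### §1 The glue: (T) + (NW) ⟺ REST‴ (item 19624's text verbatim) -/

/-- **GLUE — REST‴ (item 19624 `RamNoErratumDataAtFive`, text VERBATIM) from its two branches.** Case split
on the torsion clause: if `E(ℚ_p)[p] = 0` the crux's hypothesis says there is no odd non-split witness, so
branch (NW) applies; otherwise there is a non-zero `p`-torsion point and branch (T) applies. Bookkeeping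
only; the planner's `--split` glue. [folklore] -/
theorem rest3_of_branches (hT : Rest3TorsionBranchAtFive) (hN : Rest3NoWitnessBranchAtFive) :
    ∀ (W : WeierstrassCurve ℚ) [W.IsElliptic] [W.IsGloballyMinimal] (p : ℕ) [Fact p.Prime],
      Ram W p →
      ¬ ((∃ (q : ℕ) (_ : Fact q.Prime), q ≠ 2 ∧ q ≠ p ∧ Mult W q ∧
            ¬ W.HasSplitMultiplicativeReductionAtPrime q ∧
            ¬ p ∣ padicValInt q W.minimalDiscriminantInt) ∧
          (∀ P : (W.baseChange ℚ_[p]).toAffine.Point, p • P = 0 → P = 0)) →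
      P2OpenInputOnTreeAt W p := by
  intro W _ _ p _ hram h
  by_cases htors : ∀ P : (W.baseChange ℚ_[p]).toAffine.Point, p • P = 0 → P = 0
  · exact hN W p hram htors fun hq ↦ h ⟨hq, htors⟩
  · push Not at htors
    exact hT W p hram htors

/-- **Branch (T) is a restriction of REST‴** (nothing invented): a non-zero `p`-torsion point refutes the
torsion conjunct of the crux's hypothesis. Bookkeeping only. [folklore] -/
theorem rest3TorsionBranchAtFive_of_rest3
    (h : ∀ (W : WeierstrassCurve ℚ) [W.IsElliptic] [W.IsGloballyMinimal] (p : ℕ) [Fact p.Prime],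
      Ram W p →
      ¬ ((∃ (q : ℕ) (_ : Fact q.Prime), q ≠ 2 ∧ q ≠ p ∧ Mult W q ∧
            ¬ W.HasSplitMultiplicativeReductionAtPrime q ∧
            ¬ p ∣ padicValInt q W.minimalDiscriminantInt) ∧
          (∀ P : (W.baseChange ℚ_[p]).toAffine.Point, p • P = 0 → P = 0)) →
      P2OpenInputOnTreeAt W p) :
    Rest3TorsionBranchAtFive := by
  intro W _ _ p _ hram hP
  refine h W p hram ?_
  rintro ⟨-, htors⟩
  obtain ⟨P, hP0, hne⟩ := hP
  exact hne (htors P hP0)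

/-- **Branch (NW) is a restriction of REST‴** (nothing invented): with no odd non-split witness the witness
conjunct of the crux's hypothesis fails. Bookkeeping only. [folklore] -/
theorem rest3NoWitnessBranchAtFive_of_rest3
    (h : ∀ (W : WeierstrassCurve ℚ) [W.IsElliptic] [W.IsGloballyMinimal] (p : ℕ) [Fact p.Prime],
      Ram W p →
      ¬ ((∃ (q : ℕ) (_ : Fact q.Prime), q ≠ 2 ∧ q ≠ p ∧ Mult W q ∧
            ¬ W.HasSplitMultiplicativeReductionAtPrime q ∧
            ¬ p ∣ padicValInt q W.minimalDiscriminantInt) ∧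
          (∀ P : (W.baseChange ℚ_[p]).toAffine.Point, p • P = 0 → P = 0)) →
      P2OpenInputOnTreeAt W p) :
    Rest3NoWitnessBranchAtFive :=
  fun W _ _ p _ hram _ hq ↦ h W p hram fun hh ↦ hq hh.1

/-- **The split is LOSSLESS: REST‴ ⟺ (T) ∧ (NW).** Bookkeeping only. [folklore] -/
theorem rest3_iff_branches :
    (∀ (W : WeierstrassCurve ℚ) [W.IsElliptic] [W.IsGloballyMinimal] (p : ℕ) [Fact p.Prime],
      Ram W p →
      ¬ ((∃ (q : ℕ) (_ : Fact q.Prime), q ≠ 2 ∧ q ≠ p ∧ Mult W q ∧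
            ¬ W.HasSplitMultiplicativeReductionAtPrime q ∧
            ¬ p ∣ padicValInt q W.minimalDiscriminantInt) ∧
          (∀ P : (W.baseChange ℚ_[p]).toAffine.Point, p • P = 0 → P = 0)) →
      P2OpenInputOnTreeAt W p) ↔
    (Rest3TorsionBranchAtFive ∧ Rest3NoWitnessBranchAtFive) :=
  ⟨fun h ↦ ⟨rest3TorsionBranchAtFive_of_rest3 h, rest3NoWitnessBranchAtFive_of_rest3 h⟩,
    fun h ↦ rest3_of_branches h.1 h.2⟩

/-! ### §2 The X11b-sharp forms (the rows where the conclusion is not vacuous) -/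

section Sharp

variable {W : WeierstrassCurve ℚ} [W.IsElliptic] [W.IsGloballyMinimal] {p : ℕ} [Fact p.Prime]

omit [W.IsElliptic] in
/-- **In branch (NW) the (ram) witness is `2` or split multiplicative.** If `ℓ ≠ p` is multiplicative with
`p ∤ v_ℓ(Δ_min)` (the `Ram` witness) and there is no ODD NON-SPLIT such prime, then `ℓ = 2` or the
reduction at `ℓ` is split. Bookkeeping for the census (branch (NW) = «all ramified witnesses split» ∪ «only
`q = 2` non-split»). [folklore] -/
theorem exists_ramWitness_two_or_split_of_noOddNonsplitWitness (hram : Ram W p)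
    (hno : ¬ (∃ (q : ℕ) (_ : Fact q.Prime), q ≠ 2 ∧ q ≠ p ∧ Mult W q ∧
        ¬ W.HasSplitMultiplicativeReductionAtPrime q ∧ ¬ p ∣ padicValInt q W.minimalDiscriminantInt)) :
    ∃ (ℓ : ℕ) (_ : Fact ℓ.Prime), ℓ ≠ p ∧ Mult W ℓ ∧ ¬ p ∣ padicValInt ℓ W.minimalDiscriminantInt ∧
      (ℓ = 2 ∨ W.HasSplitMultiplicativeReductionAtPrime ℓ) := by
  obtain ⟨ℓ, hℓ, hℓp, hmℓ, hvℓ⟩ := hram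
  refine ⟨ℓ, hℓ, hℓp, hmℓ, hvℓ, ?_⟩
  by_contra hcon
  push Not at hcon
  exact hno ⟨ℓ, hℓ, hcon.1, hℓp, hmℓ, hcon.2, hvℓ⟩

end Sharp

/-- **Branch (T), X11b-SHARP FORM: (T) ⟺ its restriction to the split exceptional rows.** On the pairs where
`P2OpenInputOnTreeAt W p` is not vacuous (`ClassX11b W p`, `5 ≤ p`, `Surj W p`), a non-zero `p`-torsion
point of `E(ℚ_p)` at the multiplicative `p` forces `p` SPLIT, `p ∣ v_p(Δ_min)`, `p ∣ c_p`, `p ∣ ∏_ℓ c_ℓ`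
(`LocalTorsion.split_and_dvd_of_localTorsion_ne_zero`); so branch (T) is EQUIVALENT to the same statement
with these six extra hypotheses. This is the row description the census sizes (Tate: `E(ℚ_p)[p] ≠ 0` iff
`q_E ∈ (ℚ_p^×)^p` iff split ∧ `p ∣ v_p(Δ_min)` ∧ `j₀^{p−1} ≡ 1 (mod p²)`, `j₀ = j·p^{v_p(Δ_min)}`).
Bookkeeping only. [cite: SilvermanATAEC1994, Cor. IV.9.2(d) with (b) (PDF p. 340)]
[cite: Castella2018Erratum, Thm. 1.1 (iv), Thm. A′ (2) and Remark (pp. 1–2)] -/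
theorem rest3TorsionBranchAtFive_iff_sharp :
    Rest3TorsionBranchAtFive ↔
    ∀ (W : WeierstrassCurve ℚ) [W.IsElliptic] [W.IsGloballyMinimal] (p : ℕ) [Fact p.Prime],
      ClassX11b W p → 5 ≤ p → Surj W p → Ram W p →
      W.HasSplitMultiplicativeReductionAtPrime p →
      p ∣ padicValInt p W.minimalDiscriminantInt →
      p ∣ (W.baseChange ℚ_[p]).localTamagawaNumber ℤ_[p] →
      p ∣ W.tamagawaProduct →
      (∃ P : (W.baseChange ℚ_[p]).toAffine.Point, p • P = 0 ∧ P ≠ 0) →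
      P2OpenInputOnTreeAt W p := by
  constructor
  · intro h W _ _ p _ _ _ _ hram _ _ _ _ hP
    exact h W p hram hP
  · intro h W _ _ p _ hram hP
    refine p2OpenInputOnTreeAt_of_imp_surj W p fun hX hp5 hs ↦ ?_
    obtain ⟨P, hP0, hne⟩ := hP
    obtain ⟨hsp, hv, hc, htam⟩ :=
      LocalTorsion.split_and_dvd_of_localTorsion_ne_zero W p (by omega) hX.2.2.1 P hP0 hne
    exact h W p hX hp5 hs hram hsp hv hc htam ⟨P, hP0, hne⟩

/-- **Branch (NW), X11b-SHARP FORM: (NW) ⟺ its restriction to `ClassX11b ∧ 5 ≤ p ∧ Surj`, with the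
no-witness clause in ∀-form** (every odd multiplicative `q ≠ p` of non-split reduction has
`p ∣ v_q(Δ_min)` — the binder shape of imc-p1's atom (α), `rest3_of_noOddWitness_of_localTorsionNeZero`).
Bookkeeping only. [folklore] -/
theorem rest3NoWitnessBranchAtFive_iff_sharp :
    Rest3NoWitnessBranchAtFive ↔
    ∀ (W : WeierstrassCurve ℚ) [W.IsElliptic] [W.IsGloballyMinimal] (p : ℕ) [Fact p.Prime],
      ClassX11b W p → 5 ≤ p → Surj W p → Ram W p →
      (∀ P : (W.baseChange ℚ_[p]).toAffine.Point, p • P = 0 → P = 0) →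
      (∀ (q : ℕ) [Fact q.Prime], q ≠ 2 → q ≠ p → Mult W q →
        ¬ W.HasSplitMultiplicativeReductionAtPrime q → p ∣ padicValInt q W.minimalDiscriminantInt) →
      P2OpenInputOnTreeAt W p := by
  constructor
  · intro h W _ _ p _ _ _ _ hram htors hα
    refine h W p hram htors ?_
    rintro ⟨q, hq, hq2, hqp, hmq, hnsq, hvq⟩
    exact hvq (@hα q hq hq2 hqp hmq hnsq)
  · intro h W _ _ p _ hram htors hno
    refine p2OpenInputOnTreeAt_of_imp_surj W p fun hX hp5 hs ↦ h W p hX hp5 hs hram htors ?_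
    intro q _ hq2 hqp hmq hnsq
    by_contra hvq
    exact hno ⟨q, ‹_›, hq2, hqp, hmq, hnsq, hvq⟩

/-! ### §3 The standing reductions, restricted to each branch (CONDITIONAL; nothing booked) -/

/-- **Branch (T) ⟸ the VALUE-FREE shape (2.4)∃♭ on its rows + print.** If `P2.IMCDivSomeFrameOnTree W p`
(one inclusion of the anticyclotomic IMC for SOME BDP frame at the classical Heegner data; OPEN,
conjecture-tagged) holds at every (ram) pair with `E(ℚ_p)[p] ≠ 0`, then branch (T) — by bdp g12's pair-level
`openInputOnTreeAt_of_imcDivSomeFrame_of_pNew` (modularity, GZK, Kolyvagin, the cited Poitou–Tate ∕ local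
Euler characteristic, and the REVIEWED JIMJ18 fact `thm210_thm211_bdpDisplay_pNew` for the value at `𝟙`).
CONDITIONAL; no road to (2.4)∃♭ at these rows is claimed.
[cite: Castella2018Exceptional, Thms. 2.10–2.11 (arXiv:1507.04260 pp. 13–14)]
[cite: Castella2018Erratum, (2.4) (p. 4)] [cite: Castella2018, Thms. 2.3, 3.1, 3.2, §5]
[cite: MilneADT2006, Ch. I, Thm. 4.10(b) and Thm. 2.8] -/
theorem rest3TorsionBranchAtFive_of_imcDivSomeFrame_of_pNew (hnf : exists_isNewformOf)
    (hGZK : rank_eq_analyticRank_of_analyticRank_le_one)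
    (hKo : ∀ (N : ℕ) [NeZero N] (W : WeierstrassCurve ℚ) (K : Type) [Field K] [NumberField K],
      kolyvagin N W K)
    (hPT : ∀ (K : Type) [Field K] [NumberField K], poitouTate_sum_localTatePairing_eq_zero K)
    (hEP : ∀ (K : Type) [Field K] [NumberField K] (v : HeightOneSpectrum (𝓞 K)),
      localEulerPoincareCharacteristic (v.adicCompletion K))
    (hB : thm210_thm211_bdpDisplay_pNew)
    (hDiv : ∀ (W : WeierstrassCurve ℚ) [W.IsElliptic] [W.IsGloballyMinimal] (p : ℕ) [Fact p.Prime],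
      Ram W p → (∃ P : (W.baseChange ℚ_[p]).toAffine.Point, p • P = 0 ∧ P ≠ 0) →
      P2.IMCDivSomeFrameOnTree W p) :
    Rest3TorsionBranchAtFive :=
  fun W _ _ p _ hram hP ↦
    openInputOnTreeAt_of_imcDivSomeFrame_of_pNew hnf hGZK hKo hPT hEP hB (hDiv W p hram hP)

/-- **Branch (NW) ⟸ the VALUE-FREE shape (2.4)∃♭ on its rows + print** (same published ∕ cited binders and
the JIMJ18 fact as for branch (T); bdp g12's `openInputOnTreeAt_of_imcDivSomeFrame_of_pNew`). CONDITIONAL;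
no road to (2.4)∃♭ at these rows is claimed (none in print: BCS25 Thm. 1.2.4 is good ordinary; FW21
Thm. 4.41 ∕ Castella 2024 Thm. 3.1 (iii) need a non-split `q ∥ N`).
[cite: Castella2018Exceptional, Thms. 2.10–2.11 (arXiv:1507.04260 pp. 13–14)]
[cite: Castella2018Erratum, (2.4) (p. 4)] [cite: Castella2018, Thms. 2.3, 3.1, 3.2, §5]
[cite: MilneADT2006, Ch. I, Thm. 4.10(b) and Thm. 2.8] -/
theorem rest3NoWitnessBranchAtFive_of_imcDivSomeFrame_of_pNew (hnf : exists_isNewformOf)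
    (hGZK : rank_eq_analyticRank_of_analyticRank_le_one)
    (hKo : ∀ (N : ℕ) [NeZero N] (W : WeierstrassCurve ℚ) (K : Type) [Field K] [NumberField K],
      kolyvagin N W K)
    (hPT : ∀ (K : Type) [Field K] [NumberField K], poitouTate_sum_localTatePairing_eq_zero K)
    (hEP : ∀ (K : Type) [Field K] [NumberField K] (v : HeightOneSpectrum (𝓞 K)),
      localEulerPoincareCharacteristic (v.adicCompletion K))
    (hB : thm210_thm211_bdpDisplay_pNew)
    (hDiv : ∀ (W : WeierstrassCurve ℚ) [W.IsElliptic] [W.IsGloballyMinimal] (p : ℕ) [Fact p.Prime],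
      Ram W p → (∀ P : (W.baseChange ℚ_[p]).toAffine.Point, p • P = 0 → P = 0) →
      ¬ (∃ (q : ℕ) (_ : Fact q.Prime), q ≠ 2 ∧ q ≠ p ∧ Mult W q ∧
          ¬ W.HasSplitMultiplicativeReductionAtPrime q ∧ ¬ p ∣ padicValInt q W.minimalDiscriminantInt) →
      P2.IMCDivSomeFrameOnTree W p) :
    Rest3NoWitnessBranchAtFive :=
  fun W _ _ p _ hram htors hno ↦
    openInputOnTreeAt_of_imcDivSomeFrame_of_pNew hnf hGZK hKo hPT hEP hB (hDiv W p hram htors hno)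

/-- **Branch (T) ⟸ the LOWER HALF `Typed.MissingLowerBoundAt` (`ord_p #Ш(E)_an ≤ ord_p #Ш(E)`) on its rows +
the Jetchev–Skinner–Wan control fact** (one-sided tightness with control discharged,
`openInputOnTreeAt_of_missingLowerBoundAt_of_ram_of_thm331Mult`: Gross–Zagier, Kolyvagin, Skinner 2016
Thm. C for the classical twist, GZK, modularity). So on branch (T) the crux asks exactly the main-conjecture
half of `BSD(E,p)` at split exceptional `p` with `E(ℚ_p)[p] ≠ 0`. CONDITIONAL; nothing booked.
[cite: JetchevSkinnerWan2017, Thm. 3.3.1 with §3.5 (3.5.c) (arXiv:1512.06894 pp. 11, 15)]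
[cite: Castella2018, Thm. 2.3 (p. 5), Thm. 3.2 (p. 9)] [cite: Skinner2016PacificMC, Thm. C (§1) and footnote 1] -/
theorem rest3TorsionBranchAtFive_of_missingLowerBoundAt_of_thm331Mult
    (h : thm331_anticyclotomicControl_mult)
    (hGZ : ∀ (N : ℕ) [NeZero N] (W : WeierstrassCurve ℚ) (K : Type) [Field K] [NumberField K],
      gross_zagier N W K)
    (hKo : ∀ (N : ℕ) [NeZero N] (W : WeierstrassCurve ℚ) (K : Type) [Field K] [NumberField K],
      kolyvagin N W K)
    (hSk : Skinner2016.thmC_padicValRat_bsd_rank_zero)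
    (hGZK : rank_eq_analyticRank_of_analyticRank_le_one) (hmod : hasEntireLFunction_rat)
    (hlow : ∀ (W : WeierstrassCurve ℚ) [W.IsElliptic] [W.IsGloballyMinimal] (p : ℕ) [Fact p.Prime],
      Ram W p → (∃ P : (W.baseChange ℚ_[p]).toAffine.Point, p • P = 0 ∧ P ≠ 0) →
      Typed.MissingLowerBoundAt W p) :
    Rest3TorsionBranchAtFive :=
  fun W _ _ p _ hram hP ↦
    openInputOnTreeAt_of_missingLowerBoundAt_of_ram_of_thm331Mult W p h hGZ hKo hSk hGZK hmod hram
      (hlow W p hram hP)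

/-- **Branch (NW) ⟸ the LOWER HALF `Typed.MissingLowerBoundAt` on its rows + the Jetchev–Skinner–Wan
control fact** (`openInputOnTreeAt_of_missingLowerBoundAt_of_ram_of_thm331Mult`). CONDITIONAL; nothing booked.
[cite: JetchevSkinnerWan2017, Thm. 3.3.1 with §3.5 (3.5.c) (arXiv:1512.06894 pp. 11, 15)]
[cite: Castella2018, Thm. 2.3 (p. 5), Thm. 3.2 (p. 9)] [cite: Skinner2016PacificMC, Thm. C (§1) and footnote 1] -/
theorem rest3NoWitnessBranchAtFive_of_missingLowerBoundAt_of_thm331Mult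
    (h : thm331_anticyclotomicControl_mult)
    (hGZ : ∀ (N : ℕ) [NeZero N] (W : WeierstrassCurve ℚ) (K : Type) [Field K] [NumberField K],
      gross_zagier N W K)
    (hKo : ∀ (N : ℕ) [NeZero N] (W : WeierstrassCurve ℚ) (K : Type) [Field K] [NumberField K],
      kolyvagin N W K)
    (hSk : Skinner2016.thmC_padicValRat_bsd_rank_zero)
    (hGZK : rank_eq_analyticRank_of_analyticRank_le_one) (hmod : hasEntireLFunction_rat)
    (hlow : ∀ (W : WeierstrassCurve ℚ) [W.IsElliptic] [W.IsGloballyMinimal] (p : ℕ) [Fact p.Prime],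
      Ram W p → (∀ P : (W.baseChange ℚ_[p]).toAffine.Point, p • P = 0 → P = 0) →
      ¬ (∃ (q : ℕ) (_ : Fact q.Prime), q ≠ 2 ∧ q ≠ p ∧ Mult W q ∧
          ¬ W.HasSplitMultiplicativeReductionAtPrime q ∧ ¬ p ∣ padicValInt q W.minimalDiscriminantInt) →
      Typed.MissingLowerBoundAt W p) :
    Rest3NoWitnessBranchAtFive :=
  fun W _ _ p _ hram htors hno ↦
    openInputOnTreeAt_of_missingLowerBoundAt_of_ram_of_thm331Mult W p h hGZ hKo hSk hGZK hmod hram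
      (hlow W p hram htors hno)

end Summit.BirchSwinnertonDyer.BirchSwinnertonDyer.Theorems

end
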